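import Mathlib
import Literature.NumberTheory.Automorphic.ModularParseval
import Literature.NumberTheory.Automorphic.SpectralResolutionSmallSpectrum

/-!
# The spectral resolution of `L²(SL₂(ℤ)\ℍ)` in the general-`Γ` schema, and (12.5) for `SL₂(ℤ)` through the general assembly
(Iwaniec, *Spectral Methods of Automorphic Forms*, GSM 53, Thm 7.3 (7.15) & Thm 4.7 (4.15) for the
modular group, (3.26) (the residual spectrum of `SL₂(ℤ)` is the constant `u₀ = (3/π)^{1/2}`),
Thm 7.4 (7.17), (12.5); PDF pp. 47, 52, 75–76, 125–126)

A genuine model of the hypothesis schema `SpectralResolution Γ F` (`SpectralResolution.lean`): for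
`Γ = SL₂(ℤ)` and the standard fundamental domain `𝒟`, the PROVED Parseval identity of the tree
(`ModularParseval.hasModularParseval`: `‖f‖² = (3/π)|∫f|² + ‖P_𝓒f‖² + (1/4π)∫|⟨E(·,½+ir), f⟩|²` for
the modular test functions `IsFdTest`) yields `SpectralResolution 𝒮ℒ 𝒟`
(`nonempty_modularSpectralResolution`): the discrete family is the constant `u₀ = √(3/π)` (`λ = 0`)
together with a Hilbert basis of Maass cusp forms of `𝓒` (`λ = 1/4 + t²`, `t ∈ ℝ` by Roelcke's
bound), the single eigenpacket is `E(z, 1/2 + ir) = eisensteinCrit`. The only new point is that the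
general test functions (`IsFdTestOn`: compact support mod `Γ`) are modular test functions
(`IsFdTestOn.isFdTest`: a point of `𝒟` with a translate in a compact set has bounded height, as
`Im γw ∈ {Im w} ∪ (0, 1/Im w]` for `γ ∈ SL₂(ℤ)`). Consequently the general pipeline
(`SpectralResolutionSmallSpectrum`) gives, for `SL₂(ℤ)`, a spectral datum for EVERY small
eigenbasis and (12.5) in the general form (`modular_nonempty_spectralDatum`, `modular_eq_12_5`) —
a second route to `Iwaniec2002_eq_12_5_modular_holds`, and a non-vacuity check of the schema on
which `Iwaniec2002_eq_12_5_of_spectralResolution` is conditioned. Everything is PROVED; nothing is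
vendored; no fact is introduced.

## References
* [Iwaniec2002] H. Iwaniec, *Spectral Methods of Automorphic Forms*, 2nd ed., GSM 53, AMS 2002,
  Thm 7.3 & Thm 4.7, PDF pp. 52, 75; (3.26), PDF p. 47; Thm 7.4, PDF p. 76; (12.5), PDF pp. 125–126
  (held copy `book:iwaniec2002-spectral-methods-automorphic-forms`).

Literature: `hasModularParseval`, `IsFdTest`, `HasModularParseval`, `eisenCoeff`,
`im_modular_smul_eq_or_le`, `inner_coe_toLp_eq` (`ModularParseval`, `ModularPretraceFromParseval`);
`exists_hilbertBasis_maassCuspForms`, `IsMaassCuspForm` (`MaassCuspForms`); `IsMaassCuspForm.eigenvalue_ge`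
(`RoelckeSelbergBound`); `eisensteinCrit`, `isAutomorphic_eisensteinCrit`, `isC2_and_eigen_eisensteinCrit`,
`continuous_eisensteinCrit` (`ModularEisensteinCriticalLine`); `inner_oneLp_left`,
`inner_oneLp_eq_zero_of_mem_cuspSubmodule` (`EisensteinSpectralProjection`); `integral_fd_one`
(`EisensteinOrthogonality`); `volume_modular_fd_lt_top`, `isHypFundamentalDomain_modular_fd`,
`modular_le_range_toGL`, `neg_one_mem_modular`, `isDiscreteSubgroup_modular` (`HyperbolicLaplaceSpectrum`);
`SpectralResolution`, `SpectralResolution.nonempty_spectralDatum`, `SpectralDatum.eq_12_5`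
(`SpectralResolution`, `SpectralResolutionSmallSpectrum`, `PretraceEstimate`).
-/

noncomputable section

open MeasureTheory Set Filter Real UpperHalfPlane
open scoped Topology MatrixGroups ComplexConjugate NNReal ENNReal Modular InnerProductSpace

namespace Literature.NumberTheory.Automorphic

local notation "Γℤ" => (𝒮ℒ : Subgroup (GL (Fin 2) ℝ))
set_option quotPrecheck false in
/-- The measure of `L²(𝒟)`. -/
local notation "μ𝒟" => MeasureTheory.Measure.restrict (volume : Measure ℍ) (ModularGroup.fd)

/-! ## 1. Test functions of compact support mod `SL₂(ℤ)` are modular test functions -/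

/-- **A point of `𝒟` with an `SL₂(ℤ)`-translate in a compact set has bounded height**: if
`γz ∈ K` then `Im z ≤ max_K Im` or `Im z ≤ 1/min_K Im` (`Im γw = Im w` or `≤ 1/Im w`). Hence a
test function on `𝒟` in the sense of `IsFdTestOn` (compact support mod `Γ`) vanishes high in the
cusp, i.e. is a modular test function `IsFdTest`. [folklore] -/
theorem IsFdTestOn.isFdTest {f : ℍ → ℂ} (hf : IsFdTestOn Γℤ ModularGroup.fd f) : IsFdTest f := by
  obtain ⟨K, hK, hKf⟩ := hf.support
  refine ⟨hf.aestronglyMeasurable, hf.bounded, ?_⟩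
  by_cases hKe : K = ∅
  · refine ⟨1, fun z hz _ => ?_⟩
    by_contra hne
    obtain ⟨γ, -, hγz⟩ := hKf z hz hne
    rw [hKe] at hγz
    exact hγz
  · have hKne : K.Nonempty := Set.nonempty_iff_ne_empty.mpr hKe
    -- the extreme heights on `K`
    obtain ⟨wmax, hwmax, hmax⟩ := hK.exists_isMaxOn hKne UpperHalfPlane.continuous_im.continuousOn
    obtain ⟨wmin, hwmin, hmin⟩ := hK.exists_isMinOn hKne UpperHalfPlane.continuous_im.continuousOn
    set Y : ℝ := max wmax.im (wmin.im)⁻¹ + 1 with hY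
    refine ⟨Y, fun z hz hzY => ?_⟩
    by_contra hne
    obtain ⟨γ, hγ, hγz⟩ := hKf z hz hne
    obtain ⟨g, hg⟩ := hγ
    have e : γ • z = g • z := by rw [← hg]; rfl
    rw [e] at hγz
    have h1 : (g • z).im ≤ wmax.im := hmax hγz
    have h2 : wmin.im ≤ (g • z).im := hmin hγz
    have hzpos := z.im_pos
    have hminpos := wmin.im_pos
    rcases im_modular_smul_eq_or_le g z with h | h
    · rw [h] at h1
      have : wmax.im < Y := by rw [hY]; linarith [le_max_left wmax.im (wmin.im)⁻¹]
      linarith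
    · -- `wmin.im ≤ Im(gz) ≤ 1/Im z ≤ 1/Y < wmin.im`
      have hYpos : 0 < Y := by rw [hY]; positivity
      have h3 : z.im⁻¹ ≤ Y⁻¹ := by
        rw [inv_le_inv₀ hzpos hYpos]; exact hzY
      have h4 : Y⁻¹ < wmin.im := by
        rw [inv_lt_comm₀ hYpos hminpos, hY]
        linarith [le_max_right wmax.im (wmin.im)⁻¹]
      linarith

/-! ## 2. The spectral resolution of `L²(SL₂(ℤ)\ℍ)` -/

/-- **`SpectralResolution 𝒮ℒ 𝒟` from the proved Parseval identity of `L²(SL₂(ℤ)\ℍ)`**: the discrete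
family `{√(3/π)} ∪ {u_x}` (a Hilbert basis of Maass cusp forms with real spectral parameters),
`c = 1`, `E = eisensteinCrit`, and Parseval for test functions of compact support mod `Γ` from
`hasModularParseval` (Theorems 4.7 & 7.3 for `SL₂(ℤ)`, in the tree).
[cite: Iwaniec2002, Thm 7.3 (7.15) & Thm 4.7 (4.15) & (3.26), PDF pp. 47, 52, 75] -/
theorem nonempty_modularSpectralResolution : Nonempty (SpectralResolution Γℤ ModularGroup.fd) := by
  classical
  haveI : IsFiniteMeasure μ𝒟 := isFiniteMeasure_restrict_fd
  obtain ⟨s, b, hs, hb, hmem⟩ := exists_hilbertBasis_maassCuspForms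
  haveI : Countable s := hs.to_subtype
  -- the Maass cusp forms representing the basis vectors, with real spectral parameters
  choose U T hUT hUx _ using fun x : s => hmem x.1 x.2
  have hbx : ∀ x : s, ((b x : cuspSubmodule) : Lp ℂ 2 μ𝒟) = ((x.1 : cuspSubmodule) : Lp ℂ 2 μ𝒟) := fun x => by
    rw [show b x = x.1 from congrFun hb x]
  have hub : ∀ x : s, U x =ᵐ[μ𝒟] ((b x : cuspSubmodule) : Lp ℂ 2 μ𝒟) := fun x => by rw [hbx]; exact hUx x
  have hL2 : ∀ x : s, MemLp (U x) 2 μ𝒟 := fun x => (Lp.memLp _).ae_eq (hub x).symm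
  have hsq : ∀ x : s, IntegrableOn (fun z => ‖U x z‖ ^ 2) ModularGroup.fd := fun x =>
    (memLp_two_iff_integrable_sq_norm (hL2 x).1).mp (hL2 x)
  have hne : ∀ x : s, ∃ z, U x z ≠ 0 := by
    intro x
    by_contra hall
    push Not at hall
    have h0 : U x = 0 := funext hall
    have hbx0 : (b x : cuspSubmodule) = 0 := by
      have h1 : ((b x : cuspSubmodule) : Lp ℂ 2 μ𝒟) = 0 := by
        apply Lp.eq_zero_iff_ae_eq_zero.mpr
        have := (hub x).symm
        rw [h0] at this
        exact this
      exact_mod_cast h1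
    exact b.orthonormal.ne_zero x hbx0
  have hreal : ∀ x : s, (T x).im = 0 := fun x => by
    obtain ⟨_, _, _, him⟩ := (hUT x).eigenvalue_ge (hsq x) (hne x)
    exact him
  set t : s → ℝ := fun x => (T x).re with ht
  have htT : ∀ x : s, ((t x : ℝ) : ℂ) = T x := fun x => by
    apply Complex.ext <;> simp [ht, hreal x]
  have hu : ∀ x : s, IsMaassCuspForm (U x) (t x) := fun x => by rw [htT]; exact hUT x
  -- orthonormality of the cusp forms on `𝒟`
  have horth : ∀ x y : s, ∫ z in ModularGroup.fd, U x z * conj (U y z) = if x = y then 1 else 0 := by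
    intro x y
    have h := orthonormal_iff_ite.mp b.orthonormal y x
    rw [Submodule.coe_inner, L2.inner_def] at h
    have e : (fun z => ⟪((b y : cuspSubmodule) : Lp ℂ 2 μ𝒟) z, ((b x : cuspSubmodule) : Lp ℂ 2 μ𝒟) z⟫_ℂ) =ᵐ[μ𝒟]
        fun z => U x z * conj (U y z) := by
      filter_upwards [hub x, hub y] with z hx hy
      rw [← hx, ← hy]
      simp
    rw [integral_congr_ae e] at h
    rw [h]
    by_cases hxy : x = y
    · subst hxy; simp
    · rw [if_neg hxy, if_neg (Ne.symm hxy)]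
  -- cusp forms have mean zero on `𝒟` (orthogonality to the residual spectrum `1`)
  have hmean : ∀ x : s, ∫ z in ModularGroup.fd, U x z = 0 := by
    intro x
    have h := inner_oneLp_eq_zero_of_mem_cuspSubmodule (b x).2
    rw [inner_oneLp_left] at h
    rw [← h]
    exact integral_congr_ae (hub x)
  -- the constant
  set c₀ : ℝ := Real.sqrt (3 / π) with hc₀
  have hc₀sq : c₀ ^ 2 = 3 / π := Real.sq_sqrt (by positivity)
  have hπ := Real.pi_pos
  refine ⟨{
    ι := Unit ⊕ s
    countable_ι := inferInstance
    lam := Sum.elim (fun _ => 0) (fun x => 1 / 4 + t x ^ 2)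
    u := Sum.elim (fun _ _ => (c₀ : ℂ)) (fun x => U x)
    c := 1
    E := fun _ => eisensteinCrit
    automorphic_u := by rintro (_ | x); exacts [isAutomorphic_const _ _, (hu x).automorphic]
    isC2_u := by rintro (_ | x); exacts [isC2_const _, (hu x).isC2]
    eigen_u := by
      rintro (_ | x) z
      · simp only [Sum.elim_inl, Complex.ofReal_zero, zero_mul, add_zero]
        exact hypLaplacian_const _ z
      · simp only [Sum.elim_inr]
        have := (hu x).eigen z
        push_cast
        exact this
    sqIntegrable_u := by
      rintro (_ | x)
      · simp only [Sum.elim_inl, Complex.norm_real, Real.norm_eq_abs]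
        exact integrableOn_const volume_modular_fd_lt_top.ne
      · exact hsq x
    norm_u := by
      rintro (_ | x)
      · show ∫ z in ModularGroup.fd, (c₀ : ℂ) * conj (c₀ : ℂ) = 1
        rw [Complex.conj_ofReal, show (fun _ : ℍ => (c₀ : ℂ) * (c₀ : ℂ)) = fun _ => ((c₀ ^ 2 : ℝ) : ℂ) * 1 by
          funext z; push_cast; ring, integral_const_mul, integral_fd_one, hc₀sq]
        push_cast
        field_simp
      · show ∫ z in ModularGroup.fd, U x z * conj (U x z) = 1
        rw [horth x x, if_pos rfl]
    orthogonal_u := by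
      rintro (_ | x) (_ | y) hne'
      · exact absurd rfl hne'
      · show ∫ z in ModularGroup.fd, (c₀ : ℂ) * conj (U y z) = 0
        rw [integral_const_mul, ← Complex.conj_conj (∫ z in ModularGroup.fd, conj (U y z)), integral_conj]
        simp [hmean y]
      · show ∫ z in ModularGroup.fd, U x z * conj (c₀ : ℂ) = 0
        rw [integral_mul_const, hmean x, zero_mul]
      · show ∫ z in ModularGroup.fd, U x z * conj (U y z) = 0
        rw [horth x y, if_neg (fun h => hne' (by rw [h]))]
    finite_small := by
      refine (Set.finite_range (Sum.inl : Unit → Unit ⊕ s)).subset ?_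
      rintro (a | x) hx
      · exact ⟨a, rfl⟩
      · exfalso
        simp only [Set.mem_setOf_eq, Sum.elim_inr] at hx
        nlinarith [sq_nonneg (t x)]
    automorphic_E := fun _ r => isAutomorphic_eisensteinCrit r
    isC2_E := fun _ r => (isC2_and_eigen_eisensteinCrit r).1
    eigen_E := fun _ r z => (isC2_and_eigen_eisensteinCrit r).2 z
    continuous_E := fun _ z => continuous_eisensteinCrit z
    memLp_eisCoeff := fun f hf _ => (hasModularParseval hf.isFdTest).memLp_eisenCoeff
    parseval := fun f hf => by
      have hft : IsFdTest f := hf.isFdTest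
      have hf2 : MemLp f 2 μ𝒟 := hft.memLp_two
      have hP := (hasModularParseval hft).norm_sq_eq hf2
      -- the discrete part: the constant and the cusp forms
      have hconst : HasSum ((fun j : Unit ⊕ s => ‖∫ z in ModularGroup.fd,
          conj (Sum.elim (fun _ _ => (c₀ : ℂ)) (fun x => U x) j z) * f z‖ ^ 2) ∘ Sum.inl)
          (3 / π * ‖∫ z in ModularGroup.fd, f z‖ ^ 2) := by
        have h := hasSum_fintype fun _ : Unit => 3 / π * ‖∫ z in ModularGroup.fd, f z‖ ^ 2
        rw [Finset.sum_const, Finset.card_univ, Fintype.card_unit, one_smul] at h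
        refine h.congr_fun fun a => ?_
        simp only [Function.comp_apply, Sum.elim_inl, Complex.conj_ofReal]
        rw [integral_const_mul, norm_mul, mul_pow, Complex.norm_real, Real.norm_of_nonneg (Real.sqrt_nonneg _), hc₀sq]
      have hcusp : HasSum ((fun j : Unit ⊕ s => ‖∫ z in ModularGroup.fd,
          conj (Sum.elim (fun _ _ => (c₀ : ℂ)) (fun x => U x) j z) * f z‖ ^ 2) ∘ Sum.inr)
          (‖cuspSubmodule.orthogonalProjectionOnto (hf2.toLp f)‖ ^ 2) := by
        set v := hf2.toLp f with hv
        have hsum := b.hasSum_inner_mul_inner (cuspSubmodule.orthogonalProjectionOnto v)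
          (cuspSubmodule.orthogonalProjectionOnto v)
        have hterm : ∀ x : s, ⟪cuspSubmodule.orthogonalProjectionOnto v, b x⟫_ℂ *
            ⟪b x, cuspSubmodule.orthogonalProjectionOnto v⟫_ℂ =
            ((‖∫ z in ModularGroup.fd, conj (U x z) * f z‖ ^ 2 : ℝ) : ℂ) := by
          intro x
          rw [Submodule.inner_orthogonalProjectionOnto_eq_of_mem_right,
            Submodule.inner_orthogonalProjectionOnto_eq_of_mem_left, ← inner_conj_symm, inner_coe_toLp_eq _ hf2 (hub x),
            Complex.conj_mul', ← Complex.ofReal_pow]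
        have hnorm : ⟪cuspSubmodule.orthogonalProjectionOnto v, cuspSubmodule.orthogonalProjectionOnto v⟫_ℂ =
            ((‖cuspSubmodule.orthogonalProjectionOnto v‖ ^ 2 : ℝ) : ℂ) := by
          rw [inner_self_eq_norm_sq_to_K]; norm_cast
        simp_rw [hterm, hnorm] at hsum
        exact Complex.hasSum_ofReal.mp hsum
      rw [(hconst.sum hcusp).tsum_eq, hP, Fin.sum_univ_one]
      rfl }⟩

/-! ## 3. Consequences through the general pipeline -/

/-- **A spectral datum of `SL₂(ℤ)\ℍ` for EVERY small eigenbasis**, through the general-`Γ` pipeline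
(`SpectralResolutionSmallSpectrum`). [cite: Iwaniec2002, Thm 7.4 (7.17) & Prop. 7.2 (7.10), PDF pp. 73, 76] -/
theorem modular_nonempty_spectralDatum (B : SmallEigenbasis Γℤ ModularGroup.fd) :
    Nonempty (SpectralDatum Γℤ ModularGroup.fd B) := by
  obtain ⟨R⟩ := nonempty_modularSpectralResolution
  exact R.nonempty_spectralDatum modular_le_range_toGL neg_one_mem_modular isDiscreteSubgroup_modular
    isHypFundamentalDomain_modular_fd volume_modular_fd_lt_top B

/-- **(12.5) for `SL₂(ℤ)` with the standard fundamental domain and an arbitrary small eigenbasis**,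
through the general-`Γ` pipeline (a second route to `Iwaniec2002_eq_12_5_modular_holds`).
[cite: Iwaniec2002, (12.5), PDF pp. 125–126] -/
theorem modular_eq_12_5 (B : SmallEigenbasis Γℤ ModularGroup.fd) (z w : ℍ) :
    ∃ C : ℝ, ∀ (k : ℝ → ℝ), Continuous k → IsTestKernel k → IsAdmissibleTransform (selbergTransform k) →
      ∀ (H : ℝ → ℝ), AntitoneOn H (Ici 0) → (∀ t : ℝ, 0 ≤ t → ‖selbergTransform k t‖ ≤ H t) →
        IntegrableOn (fun t => (t + 1) * H t) (Ioi 0) →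
        ‖(automorphicKernel Γℤ k z w : ℂ) -
            2 * ∑ j, selbergTransform k (Complex.I * ((B.s j - 1 / 2 : ℝ) : ℂ)) * B.u j z * conj (B.u j w)‖ ≤
          C * (H 0 + ∫ t in Ioi 0, (t + 1) * H t) := by
  obtain ⟨D⟩ := modular_nonempty_spectralDatum B
  exact D.eq_12_5 z w

end Literature.NumberTheory.Automorphic
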